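import Summits.BirchSwinnertonDyer.BirchSwinnertonDyer.Theorems.Rank2ObservatoryRank3Step2Certs1
import Summits.BirchSwinnertonDyer.BirchSwinnertonDyer.Theorems.Rank2ObservatoryRank3Step2Certs2
import Summits.BirchSwinnertonDyer.BirchSwinnertonDyer.Theorems.Rank2ObservatoryRank3Step2Certs3
import Summits.BirchSwinnertonDyer.BirchSwinnertonDyer.Theorems.Rank2ObservatoryRank3RootNumber3Census
import HarnessLib

/-!
# BSD rank ≥ 2 observatory (`b2b-bsdr2`, cert-2 gen 6): `N_E = N` HYPOTHESIS-FREE for the `749`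
# rank-3 census rows ADDITIVE AT `2` of Kodaira type `II`, `III`, `IV` (tame at `3`) — Tate certificates

HONEST FRAMING: per-curve certified theorems and census instruments; no claim on BSD in rank ≥ 2.

`Rank2ObservatoryRank3ConductorFinal` discharged `hN : conductorNorm ℤ E = N` with NO named fact for
the `5347` census rows tame at `2` and at `3`; the `3024` rows ADDITIVE at `2` were left with `hN` as a
hypothesis ("would need Tate's algorithm run on each equation").  This file runs it — Steps 1–5, in the
KERNEL — for the `749` of them whose Kodaira type at `2` is `II`, `III` or `IV` and which carry a gen-5
root-number certificate (i.e. are tame at `3`): the three data chunks `rank3Step2Certs1..3` list a TATE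
CERTIFICATE at `2` (`Rank2ObservatoryTateStep2Cert.Step2Cert`) per row, the chunk theorems
`rank3Table_step2Walk1..3` evaluate the one-pass walk `step2Walk` over `rank3Table.zip rank3RNCerts`
(`Rank2ObservatoryConductorCertStep2`), and `Rank3Row.conductorNorm_eq_of_step2Walk` turns each
listed pair into `conductorNorm ℤ E_row = N_row` — Ogg's formula `f₂ = v₂(Δ) + 1 − m` is the tree's
definition of the conductor exponent and the Tate evaluations are the tree's theorems, so NO named fact
and NO hypothesis remains:

* `rank3Step2Certs` (the `749` pairs), `rank3Step2Certs_length`, the Kodaira census at `2` of these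
  rows by kernel count (`II : 11`, `III : 303`, `IV : 435`) and `rank3Step2Certs_additive`
  (`2 ≤ f₂` on every listed row: they are disjoint from the `5347` tame rows);
* **`Rank3Row.conductorNorm_eq_of_mem_step2Certs : (i, tc) ∈ rank3Step2Certs →
  conductorNorm ℤ E_i = N_i`** and the row form `Rank3Row.conductorNorm_eq_of_step2Listed`;
* the census headline `Rank3Row.rank3_lderiv_eq_zero_of_step2Listed` — `L′(E,1) = 0` over
  `K = ℚ(√D)` with `hlow`, `hmin`, `hN` DISCHARGED (no conductor fact left), `hw` modulo the two named
  root-number facts `hKD`/`hR`.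

Running total of rank-3 rows with `N_E = N` free of any named fact: `5347 + 749 = 6096` of `9487`.
The remaining rows additive at `2` have Kodaira type `I₀*`, `Iₙ*`, `IV*`, `III*`, `II*` at `2` (Steps
6–10 of Tate's algorithm; the tree proves those evaluations too — left to gen 7) or are additive at `3`.

Cross-checks outside the proofs (unit folder): the independent engine `tate_step2.py` and PARI/GP
`elllocalred` (job `j101307`) agree on the Kodaira type and `f₂` of all `872` rows of type `II/III/IV`
at `2`; `gen_step2_chunks.py` re-evaluates the Boolean check and `2^{f₂} · ∏ p^{condExp} = N` in
Python for the `749` listed rows.  References: [Silverman1994] IV.9.4, IV.10.2, IV.11.1;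
[SilvermanAEC2009] C.16; [CremonaAlgorithms1997] §3.2 and Tables; [GrossLMS1991] (1.1), Thm. 1.3.
-/

open WeierstrassCurve IsDedekindDomain Literature Literature.NumberTheory.EllipticCurves

namespace Summit.BirchSwinnertonDyer.BirchSwinnertonDyer.Rank2Observatory

open RootNumber Tate

/-- All Tate certificates at `2` of the census (three chunks). [cite: Silverman1994, IV.9.4 Steps 1–5] -/
def rank3Step2Certs : List (ℕ × Step2Cert) :=
  rank3Step2Certs1 ++ rank3Step2Certs2 ++ rank3Step2Certs3

/-- `749` rows carry a Tate certificate at `2`. [cite: CremonaAlgorithms1997, Tables] -/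
theorem rank3Step2Certs_length : rank3Step2Certs.length = 749 := by
  decide +kernel

/-- Kodaira census at `2` of the listed rows (kernel count): `11` of type `II`, `303` of type `III`,
`435` of type `IV`. [cite: Silverman1994, IV.9.4 Steps 3–5] -/
theorem rank3Step2Certs_types :
    (rank3Step2Certs.countP fun e => e.2.exit == 2) = 11 ∧
      (rank3Step2Certs.countP fun e => e.2.exit == 3) = 303 ∧
      (rank3Step2Certs.countP fun e => e.2.exit == 4) = 435 := by
  refine ⟨?_, ?_, ?_⟩ <;> decide +kernel

/-- Every listed row is ADDITIVE at `2`: its certified conductor exponent is `≥ 2` (kernel).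
[cite: Silverman1994, IV.10.2] -/
theorem rank3Step2Certs_additive : (rank3Step2Certs.all fun e => decide (2 ≤ e.2.f)) = true := by
  decide +kernel

/-- **`N_E = N` for every row listed with a Tate certificate at `2`** — NO named fact, NO hypothesis.
[cite: Silverman1994, IV.10.2 and IV.11.1] [cite: CremonaAlgorithms1997, Tables] -/
theorem Rank3Row.conductorNorm_eq_of_mem_step2Certs {i : ℕ} {tc : Step2Cert}
    (hm : (i, tc) ∈ rank3Step2Certs) :
    ∃ hi : i < rank3Table.length, (rank3Table[i]'hi).curve.conductorNorm ℤ = (rank3Table[i]'hi).N := by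
  simp only [rank3Step2Certs, List.mem_append] at hm
  rcases hm with (h | h) | h
  · exact Rank3Row.conductorNorm_eq_of_step2Walk rank3Table_step2Walk1 h
  · exact Rank3Row.conductorNorm_eq_of_step2Walk rank3Table_step2Walk2 h
  · exact Rank3Row.conductorNorm_eq_of_step2Walk rank3Table_step2Walk3 h

/-- Row form: if `r` is the `i`-th census row and `(i, tc)` is listed, `conductorNorm ℤ E_r = r.N`.
[cite: Silverman1994, IV.10.2 and IV.11.1] -/
theorem Rank3Row.conductorNorm_eq_of_step2Listed {r : Rank3Row} {i : ℕ} {tc : Step2Cert}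
    (hm : (i, tc) ∈ rank3Step2Certs) (hr : rank3Table[i]? = some r) :
    r.curve.conductorNorm ℤ = r.N := by
  obtain ⟨hi, h⟩ := Rank3Row.conductorNorm_eq_of_mem_step2Certs hm
  obtain ⟨hi', rfl⟩ := List.getElem?_eq_some_iff.mp hr
  exact h

/-- A listed row is a census row. [folklore] -/
theorem Rank3Row.mem_of_step2Listed {r : Rank3Row} {i : ℕ} {tc : Step2Cert}
    (hm : (i, tc) ∈ rank3Step2Certs) (hr : rank3Table[i]? = some r) : r ∈ rank3Table := by
  obtain ⟨-, -⟩ := Rank3Row.conductorNorm_eq_of_mem_step2Certs hm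
  exact List.mem_of_getElem? hr

/-- **`L′(E,1) = 0` over `K = ℚ(√D)` for every census row listed with a Tate certificate at `2`, with
`hlow`, `hmin` AND `hN` DISCHARGED free of any named fact** (`hw` modulo the two named root-number
facts `hKD`/`hR`); the remaining hypotheses are modularity `hE`, Gross–Zagier–Kolyvagin over `K`
(`hGZKK`), `K` (`hK`, `hdK`) and the twist value `hLD`. [cite: GrossLMS1991, (1.1) and Thm. 1.3]
[cite: Silverman1994, IV.10.2 and IV.11.1] -/
theorem Rank3Row.rank3_lderiv_eq_zero_of_step2Listed {r : Rank3Row} {i : ℕ} {tc : Step2Cert}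
    (hm : (i, tc) ∈ rank3Step2Certs) (hr : rank3Table[i]? = some r) (K : Type) [Field K]
    [NumberField K] (hE : WeierstrassCurve.hasEntireLFunction_rat)
    (hGZKK : mordellWeilRank_eq_one_of_LDerivEK_ne_zero r.curve K)
    (hK : IsImaginaryQuadratic K) (hdK : NumberField.discr K = r.D)
    (hKD : r.curve.rootNumber_eq_neg_finprod_tableLocalRootNumberAt')
    (hR : r.curve.rootNumber_eq_neg_finprod_fullTableLocalRootNumberAt)
    (hLD : (r.curve.quadraticTwist (r.D : ℚ)).entireLFunction 1 ≠ 0) :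
    deriv r.curve.entireLFunction 1 = 0 :=
  Rank3Row.rank3_lderiv_eq_zero_kernel_wm (Rank3Row.mem_of_step2Listed hm hr) K hE hGZKK
    (Rank3Row.conductorNorm_eq_of_step2Listed hm hr) hK hdK hKD hR hLD

/-- Self-test: row `23` (`26284a1`, type `IV` at `2`) is listed, hence `N(E₂₃) = 26284` with no
hypothesis. [cite: CremonaAlgorithms1997, Tables] -/
example : ∃ hi : 23 < rank3Table.length, (rank3Table[23]'hi).curve.conductorNorm ℤ = (rank3Table[23]'hi).N :=
  Rank3Row.conductorNorm_eq_of_mem_step2Certs (tc := ⟨2, 1, 0, 1, 4, 4, 2⟩) (by decide +kernel)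

end Summit.BirchSwinnertonDyer.BirchSwinnertonDyer.Rank2Observatory
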